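import Summits.CriticalPhenomena.PercolationContinuityZ3.Theorems.PercNearOneGluingNoHeavyLowerTailTformOneSteinerGate
import HarnessLib

/-!
# `NoHeavyLowerTail` (stmt-CriticalPhenomena-4575) — one non-relay gate: QGATE-T at `|S| = 1` and XZ at the champion

Support file (prover `prim-hp-5`, hull-port cell, T-form calculus, gen 3; `--supports stmt-CriticalPhenomena-4575`).
No definitions, no named facts, no sorries.  Notation and setting of `…TformOneSteinerGate`: observer `o ∉ A` whose gates
(positive-weight neighbours) are relays except possibly ONE vertex `s` (arbitrary graph behind `s`); `Φ_G` / `Φ_K` the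
lightness in `G` / in `K = G − o`; T-form `μ{1 ≤ N ≤ j} ≤ μ({|π(c)| ≤ j} ∩ {1 ≤ N})`.

* `tform_of_gateDomination_oneSteinerGate` — **QGATE-T at `|S| = 1`** for this class: a vertex `c ≠ o` at least as `G`-light
  as EVERY gate is a T-form witness (the `|S| = 1`, at-most-one-Steiner-gate case of the gate-domination law QGATE-T of the
  ttrl census `run/shared/lean/ttrl/tcs/README.md`, 0 violations / 67.9 M pairs).  Via single-gate domination
  (`Theorems.tform_of_dominates_lightestGate`) at a `K`-lightest gate.
* `attachedChampion_oneSteinerGate` — **XZ at the champion** (the registered stub `stub_attachedChampion` at this instance)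
  for such observers whenever some relay is at least as `K`-light as every gate (e.g. a `K`-lightest gate is a relay): a
  champion dominates that relay in `G`.  The remaining case for this class — the unique `K`-lightest gate is the non-relay
  `s` and it is strictly `G`-lighter than the champion — is not covered.
-/

noncomputable section

namespace Summit.CriticalPhenomena.PercolationContinuityZ3.Theorems

open MeasureTheory Set Literature.Probability.LatticeModels Literature.Probability.Percolation
open scoped Classical BigOperators

variable {n : ℕ}

open CutObserver in
/-- **QGATE-T at `|S| = 1` for observers with at most one non-relay gate.**  Let `o ∉ A` have relay gates and possibly the one
further neighbour `s ≠ o` (arbitrary graph behind `s`), and at least one gate.  If `c ≠ o` is at least as `G`-light as EVERY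
gate (`Φ_G(y) ≤ Φ_G(c)` for every positive-weight neighbour `y` of `o`), then `μ{1 ≤ N ≤ j} ≤ μ({|π(c)| ≤ j} ∩ {1 ≤ N})`.
(The `|S| = 1`, at-most-one-Steiner-gate case of the gate-domination law QGATE-T of the ttrl census, 0 / 67.9 M.)
[cite: VandenbergHaggstromKahn2005, Thm. 1.5 (p. 7)] -/
theorem tform_of_gateDomination_oneSteinerGate (w : Sym2 (Fin n) → unitInterval) (A : Finset (Fin n)) (o s c : Fin n)
    (j : ℕ) (hoA : o ∉ A) (hso : s ≠ o) (hco : c ≠ o)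
    (hgates : ∀ y : Fin n, y ≠ o → w s(o, y) ≠ 0 → y ∈ A ∨ y = s)
    (hsome : ∃ y : Fin n, y ≠ o ∧ w s(o, y) ≠ 0)
    (hGdom : ∀ y : Fin n, y ≠ o → w s(o, y) ≠ 0 →
      (prodBernoulli w).real {ω : BondConfig (Fin n) | (A.filter fun z => ω ∈ openConn y z).card ≤ j} ≤
        (prodBernoulli w).real {ω : BondConfig (Fin n) | (A.filter fun z => ω ∈ openConn c z).card ≤ j}) :
    (prodBernoulli w).real {ω : BondConfig (Fin n) |
        1 ≤ (A.filter fun x => ω ∈ openConn o x).card ∧ (A.filter fun x => ω ∈ openConn o x).card ≤ j} ≤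
      (prodBernoulli w).real {ω : BondConfig (Fin n) |
        (A.filter fun x => ω ∈ openConn c x).card ≤ j ∧ 1 ≤ (A.filter fun x => ω ∈ openConn o x).card} := by
  set sW : Fin n → ℝ := fun y => (prodBernoulli w).real {ω : BondConfig (Fin n) |
    (A.filter fun z => (openGraph (ω ∩ {e | o ∉ e})).Reachable y z).card ≤ j} with hsW
  set Γ : Finset (Fin n) := Finset.univ.filter fun v => v ≠ o ∧ w s(o, v) ≠ 0 with hΓ
  have hΓne : Γ.Nonempty := by
    obtain ⟨y, hyo, hwy⟩ := hsome
    exact ⟨y, Finset.mem_filter.2 ⟨Finset.mem_univ _, hyo, hwy⟩⟩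
  -- a `K`-lightest gate
  obtain ⟨g, hgΓ, hgmax⟩ := Finset.exists_max_image Γ sW hΓne
  have hg := Finset.mem_filter.1 hgΓ
  exact tform_of_dominates_lightestGate w A o s g c j hoA hso hg.2.1 hco hgates
    (fun y hyo hwy => hgmax y (Finset.mem_filter.2 ⟨Finset.mem_univ _, hyo, hwy⟩)) (hGdom g hg.2.1 hg.2.2)

open CutObserver in
/-- **XZ at the champion for observers with at most one non-relay gate, when a `K`-lightest gate is a relay.**  Let `o ∉ A`
have relay gates and possibly the one further neighbour `s ≠ o` (arbitrary graph behind `s`); let the relay `g` be at least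
as `K`-light as every gate (e.g. a `K`-lightest gate that is a relay); and let `c ∈ A` be a level-`j` champion (`μ{|π(a)| ≤ j} ≤ μ{|π(c)| ≤ j}` for all `a ∈ A`).  Then
`μ{1 ≤ N ≤ j} ≤ μ({|π(c)| ≤ j} ∩ {1 ≤ N})` — the registered stub `stub_attachedChampion` at this `(w, A, o, c, j)`.
[cite: VandenbergHaggstromKahn2005, Thm. 1.5 (p. 7)] -/
theorem attachedChampion_oneSteinerGate (w : Sym2 (Fin n) → unitInterval) (A : Finset (Fin n)) (o s g c : Fin n)
    (j : ℕ) (hoA : o ∉ A) (hso : s ≠ o) (hgA : g ∈ A) (hcA : c ∈ A)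
    (hgates : ∀ y : Fin n, y ≠ o → w s(o, y) ≠ 0 → y ∈ A ∨ y = s)
    (hdom : ∀ y : Fin n, y ≠ o → w s(o, y) ≠ 0 →
      (prodBernoulli w).real {ω : BondConfig (Fin n) |
          (A.filter fun z => (openGraph (ω ∩ {e | o ∉ e})).Reachable y z).card ≤ j} ≤
        (prodBernoulli w).real {ω : BondConfig (Fin n) |
          (A.filter fun z => (openGraph (ω ∩ {e | o ∉ e})).Reachable g z).card ≤ j})
    (hchamp : ∀ a ∈ A,
      (prodBernoulli w).real {ω : BondConfig (Fin n) | (A.filter fun z => ω ∈ openConn a z).card ≤ j} ≤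
        (prodBernoulli w).real {ω : BondConfig (Fin n) | (A.filter fun z => ω ∈ openConn c z).card ≤ j}) :
    (prodBernoulli w).real {ω : BondConfig (Fin n) |
        1 ≤ (A.filter fun x => ω ∈ openConn o x).card ∧ (A.filter fun x => ω ∈ openConn o x).card ≤ j} ≤
      (prodBernoulli w).real {ω : BondConfig (Fin n) |
        (A.filter fun x => ω ∈ openConn c x).card ≤ j ∧ 1 ≤ (A.filter fun x => ω ∈ openConn o x).card} :=
  tform_of_dominates_lightestGate w A o s g c j hoA hso (fun h => hoA (h ▸ hgA)) (fun h => hoA (h ▸ hcA)) hgates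
    hdom (hchamp g hgA)

end Summit.CriticalPhenomena.PercolationContinuityZ3.Theorems

end
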